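import Summits.ValiantsHypothesis.ValiantsHypothesis.Theorems.LacunarySymmetroidMatrixDescartesDoorA26WallBubblingWeylGenericReduction
import Summits.ValiantsHypothesis.ValiantsHypothesis.Theorems.LacunarySymmetroidMatrixDescartesDoorA26WallBubblingNullCollapse

/-!
# Wall bubbling for `DoorA26` — (W) at generic Weyl faces: THE REDUCTION WITH THE NULL-COLLAPSED RESIDUAL `NoTightChain26NC`

HONEST FRAMING.  Obligation (W) `stub_weylFaces` of `Cruxes/DoorA26/Lines/wall_bubbling.lean` (crux `DoorA26`, stmt-ValiantsHypothesis-19979; OPEN,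
typed, never asserted); statement file `Cruxes/DoorA26/Lines/wall_bubbling_ConfluentDoor.lean` rev 5 (`NoTightChain26` = W2 #27's `hchain`).  W2 seat
val-sym-door-p1 g15.  #27 proved `(W)_generic ⟸ ConfluentDoor26 ∧ NoTightChain26`; the located PROFILE CENSUS (this seat; reconciled with the line lead's
isotropy column, member-level numbers of record 5 676/10 830 two-cluster profiles) showed that the NULL-COLLAPSE consistency of W2 #32 excludes more than
half of the residual's combinatorial envelope DOOR-FREE.  THIS FILE makes that shrink citable BY NAME: the same reduction with a residual hypothesis
`hchain` that additionally RECEIVES, for every cluster `c` and letters `p q r`, the null-collapse consistency AT MEMBER LEVEL «`polar(W_c p, W_c p) =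
polar(W_c q, W_c q) = polar(W_c p, W_c q) = 0`, `W_c p` and `W_c q` each with an alive pairing ⇒ (`polar(W_c r, W_c p) = 0 ↔ polar(W_c r, W_c q) = 0`)»
(this covers value-deadness outside the active interval AND degree-forced deadness of confluent slots), and the PROPORTIONALITY itself «… ⇒ ∃ λ,
W_c p = λ • W_c q» — both derived inside the proof from #32 / the tree lemma
`polar_eq_zero_iff_of_null_collapse` (the tree's `exists_smul_of_polar_eq_zero`, Witt index one).  A prover of the residual may therefore ASSUME null-collapse
consistency; equivalently the residual's envelope is the post-collapse survivor set.  Proposed name for rev 6: `NoTightChain26NC` = this file's `hchain`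
binder byte-exact; `weylFaces_generic_of_confluentDoor_of_noTightChainNC : hdoor → hchainNC → Stmt.weylFaces_generic`.

Registers unchanged; (W)/(W-split)/`ConfluentDoor26`/`NoTightChain26(NC)`/`DoorA26`/`MatrixDescartes` (stmt-ValiantsHypothesis-18050) OPEN; nothing on VP ≠ VNP.  No new definitions.

[this work] the reduction with the collapsed residual.
-/

-- `Summit.ValiantsHypothesis.ValiantsHypothesis.…` repeats a component by the D-0017 layout
-- (single-conjunct summit), which the `dupNamespace` linter flags; the name is mandated.
set_option linter.dupNamespace false

namespace Summit.ValiantsHypothesis.ValiantsHypothesis.Theorems.LacunarySymmetroidMatrixDescartes.WallBubbling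

open Finset Filter Topology
open Bubbling (polar TwentyLocus SortedSimplex)
open scoped BigOperators

/-- **(W) AT GENERIC WEYL FACES ⟸ ConfluentDoor26 ∧ NoTightChain26NC** — the reduction of #27 with the SMALLER residual: `hchain` additionally RECEIVES the
null-collapse consistency of every cluster (derived here from #32), so a prover of the residual may assume it.  [this work] -/
theorem weylFaces_generic_of_confluentDoor_of_noTightChainNC
    (hdoor : ∀ e : Fin 5 → ℝ, Function.Injective e →
      ∀ τ T : Matrix (Fin 2) (Fin 2) ℝ, ∀ S : Fin 4 → Matrix (Fin 2) (Fin 2) ℝ,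
        τ.IsSymm → T.IsSymm → (∀ k, (S k).IsSymm) →
        (∃ t, ((Real.exp (e 0 * t)) • (τ + t • T) + ∑ k, (Real.exp (e k.succ * t)) • S k).det ≠ 0) →
        ∀ (Z : Finset ℝ) (m : ℝ → ℕ),
          (∀ z ∈ Z, ∀ j < m z,
            iteratedDeriv j (fun t => ((Real.exp (e 0 * t)) • (τ + t • T) + ∑ k, (Real.exp (e k.succ * t)) • S k).det) z = 0) →
          ∑ z ∈ Z, m z ≤ 19)
    (hchain : ∀ (δs : ℕ → Fin 6 → ℝ) (δ0 : Fin 6 → ℝ),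
      (∀ l, Tendsto (fun ν => δs ν l) atTop (𝓝 (δ0 l))) → δ0 5 = δ0 0 →
      (∀ a b c d : Fin 5, δ0 a.castSucc + δ0 b.castSucc = δ0 c.castSucc + δ0 d.castSucc → (a = c ∧ b = d) ∨ (a = d ∧ b = c)) →
      ∀ (U : ℕ → Fin 6 → Matrix (Fin 2) (Fin 2) ℝ), (∀ ν l, (U ν l).IsSymm) →
      (∀ ν, ∃ t, (∑ l, Real.exp (δs ν l * t) • U ν l).det ≠ 0) →
      ∀ (z : ℕ → Fin 20 → ℝ), (∀ ν, StrictMono (z ν)) → (∀ ν i, (∑ l, Real.exp (δs ν l * z ν i) • U ν l).det = 0) →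
      ∀ (φ : ℕ → ℕ), StrictMono φ →
      ∀ (C : ℕ) (m : Fin C → ℕ) (s : Fin C → ℕ → ℝ) (R : ℝ)
        (μ : Fin C → ℕ → ℝ) (Γ : Fin C → Fin 6 → Fin 6 → ℝ) (ε : Fin C → ℝ) (W : Fin C → Fin 6 → Matrix (Fin 2) (Fin 2) ℝ),
      ∑ c, m c = 20 → (∀ c, 1 ≤ m c) →
      (∀ c c' : Fin C, c < c' → Tendsto (fun k => s c' k - s c k) atTop atTop) →
      (∀ (c : Fin C) (k : ℕ), ∃ x : Fin (m c) → ℝ, StrictMono x ∧ ∀ i, x i ∈ Set.Icc (-R) R ∧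
        (∑ l, Real.exp (δs (φ k) l * x i) • (Real.exp (δs (φ k) l * s c k) • U (φ k) l)).det = 0) →
      (∀ c : Fin C,
        (∀ k, 0 < μ c k) ∧
        (∀ k a b, |polar
          (if a = 0 then Real.exp (δs (φ k) 0 * s c k) • U (φ k) 0 + Real.exp (δs (φ k) 5 * s c k) • U (φ k) 5
            else if a = 5 then (δs (φ k) 5 - δs (φ k) 0) • (Real.exp (δs (φ k) 5 * s c k) • U (φ k) 5)
            else Real.exp (δs (φ k) a * s c k) • U (φ k) a)
          (if b = 0 then Real.exp (δs (φ k) 0 * s c k) • U (φ k) 0 + Real.exp (δs (φ k) 5 * s c k) • U (φ k) 5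
            else if b = 5 then (δs (φ k) 5 - δs (φ k) 0) • (Real.exp (δs (φ k) 5 * s c k) • U (φ k) 5)
            else Real.exp (δs (φ k) b * s c k) • U (φ k) b)| ≤ μ c k) ∧
        (∀ a b, Tendsto (fun k => polar
          (if a = 0 then Real.exp (δs (φ k) 0 * s c k) • U (φ k) 0 + Real.exp (δs (φ k) 5 * s c k) • U (φ k) 5
            else if a = 5 then (δs (φ k) 5 - δs (φ k) 0) • (Real.exp (δs (φ k) 5 * s c k) • U (φ k) 5)
            else Real.exp (δs (φ k) a * s c k) • U (φ k) a)
          (if b = 0 then Real.exp (δs (φ k) 0 * s c k) • U (φ k) 0 + Real.exp (δs (φ k) 5 * s c k) • U (φ k) 5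
            else if b = 5 then (δs (φ k) 5 - δs (φ k) 0) • (Real.exp (δs (φ k) 5 * s c k) • U (φ k) 5)
            else Real.exp (δs (φ k) b * s c k) • U (φ k) b) / μ c k) atTop (𝓝 (Γ c a b))) ∧
        (ε c = 1 ∨ ε c = -1) ∧ (∀ l, (W c l).IsSymm) ∧ (∀ a b, Γ c a b = ε c * polar (W c a) (W c b)) ∧
        (∃ t, ((Real.exp (δ0 0 * t)) • (W c 0 + t • W c 5)
          + ∑ k : Fin 4, (Real.exp (δ0 k.succ.castSucc * t)) • W c k.succ.castSucc).det ≠ 0) ∧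
        ∀ (n : ℕ) (ψ : ℕ → ℕ), StrictMono ψ → ∀ (ts : ℕ → ℝ) (t₀ : ℝ), Tendsto ts atTop (𝓝 t₀) →
          Tendsto (fun k => iteratedDeriv n
              (fun t => ε c * (μ c (ψ k))⁻¹ *
                (∑ l, Real.exp (δs (φ (ψ k)) l * t) • (Real.exp (δs (φ (ψ k)) l * s c (ψ k)) • U (φ (ψ k)) l)).det) (ts k))
            atTop (𝓝 (iteratedDeriv n
              (fun t => ((Real.exp (δ0 0 * t)) • (W c 0 + t • W c 5)
                + ∑ k : Fin 4, (Real.exp (δ0 k.succ.castSucc * t)) • W c k.succ.castSucc).det) t₀))) →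
      ((univ : Finset (Fin 6 × Fin 6)).image (fun pq => δ0 pq.1 + δ0 pq.2)).card = 15 →
      (∀ c : Fin C, m c + 1 = ∑ w ∈ ((univ : Finset (Fin 6 × Fin 6)).image (fun pq => δ0 pq.1 + δ0 pq.2)).filter
          (fun w => (∃ p q : Fin 6, δ0 p + δ0 q = w ∧ polar (W c p) (W c q) ≠ 0)),
        ((if δ0 0 + δ0 0 = w ∧ polar (W c 5) (W c 5) ≠ 0 then 2 else if (∃ q : Fin 6, q ≠ 5 ∧ δ0 5 + δ0 q = w ∧ polar (W c 5) (W c q) ≠ 0) then 1 else 0) + 1)) →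
      (∀ c c' : Fin C, c < c' → ∀ p q p' q' : Fin 6,
        polar (W c p) (W c q) ≠ 0 → polar (W c' p') (W c' q') ≠ 0 → δ0 p + δ0 q ≤ δ0 p' + δ0 q') →
      (∑ c : Fin C, ((((univ : Finset (Fin 6 × Fin 6)).image (fun pq => δ0 pq.1 + δ0 pq.2)).filter
          (fun w => (∃ p q : Fin 6, δ0 p + δ0 q = w ∧ polar (W c p) (W c q) ≠ 0))).card - 1) = 14) →
      (∀ w ∈ ((univ : Finset (Fin 6 × Fin 6)).image (fun pq => δ0 pq.1 + δ0 pq.2)),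
        (∑ c : Fin C, if (∃ p q : Fin 6, δ0 p + δ0 q = w ∧ polar (W c p) (W c q) ≠ 0)
          then (if δ0 0 + δ0 0 = w ∧ polar (W c 5) (W c 5) ≠ 0 then 2 else if (∃ q : Fin 6, q ≠ 5 ∧ δ0 5 + δ0 q = w ∧ polar (W c 5) (W c q) ≠ 0) then 1 else 0) else 0)
        = (if w = δ0 0 + δ0 0 then 3 else if (∃ q : Fin 6, q ≠ 0 ∧ q ≠ 5 ∧ w = δ0 0 + δ0 q) then 2 else 1) - 1) →
      -- NULL-COLLAPSE CONSISTENCY (W2 #32): in every cluster, two letters dead on the diagonal with a dead mutual pairing and alive witnesses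
      -- pair dead IDENTICALLY with every third letter
      (∀ (c : Fin C) (p q r : Fin 6),
        polar (W c p) (W c p) = 0 → polar (W c q) (W c q) = 0 → polar (W c p) (W c q) = 0 →
        (∃ x : Fin 6, polar (W c p) (W c x) ≠ 0) → (∃ y : Fin 6, polar (W c q) (W c y) ≠ 0) →
        (polar (W c r) (W c p) = 0 ↔ polar (W c r) (W c q) = 0)) →
      -- NULL COLLAPSE ITSELF: such a pair of limit letters is PROPORTIONAL (the tree's `exists_smul_of_polar_eq_zero`)
      (∀ (c : Fin C) (p q : Fin 6),
        polar (W c p) (W c p) = 0 → polar (W c q) (W c q) = 0 → polar (W c p) (W c q) = 0 →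
        (∃ y : Fin 6, polar (W c q) (W c y) ≠ 0) → ∃ lam : ℝ, W c p = lam • W c q) →
      2 ≤ C → False) :
    ∀ δ : Fin 6 → ℝ, δ ∈ SortedSimplex → ∀ i j : Fin 6,
      (i < j ∧ δ i = δ j ∧ Set.InjOn (fun p : Fin 5 × Fin 5 => δ (j.succAbove p.1) + δ (j.succAbove p.2)) {p | p.1 ≤ p.2}) →
      δ ∉ closure TwentyLocus := by
  intro δ0 _ i j hgen hcl
  classical
  obtain ⟨hij, hδij, hinj⟩ := hgen
  -- (1) a sequence of twenties converging to `δ0`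
  obtain ⟨δseq, hmem, hlim⟩ := mem_closure_iff_seq_limit.mp hcl
  choose S hS hneS z hz hroot using fun ν => twenty_log_zeros_of_mem_twentyLocus (hmem ν)
  have hδ : ∀ l, Tendsto (fun ν => δseq ν l) atTop (𝓝 (δ0 l)) := fun l => (tendsto_pi_nhds.mp hlim) l
  -- (2) relabel so that the Weyl pair sits at the positions `0, 5`
  obtain ⟨σ, hσ5, hσ0, π, hσ⟩ := exists_perm_weylPair i j (ne_of_lt hij)
  have hsum : ∀ (δ : Fin 6 → ℝ) (V : Fin 6 → Matrix (Fin 2) (Fin 2) ℝ) (t : ℝ),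
      ∑ l, Real.exp (δ (σ l) * t) • V (σ l) = ∑ l, Real.exp (δ l * t) • V l :=
    fun δ V t => Equiv.sum_comp σ (fun l => Real.exp (δ l * t) • V l)
  have h05 : δ0 (σ 5) = δ0 (σ 0) := by rw [hσ5, hσ0, hδij]
  have hsid : ∀ a b c d : Fin 5, δ0 (σ a.castSucc) + δ0 (σ b.castSucc) = δ0 (σ c.castSucc) + δ0 (σ d.castSucc) →
      (a = c ∧ b = d) ∨ (a = d ∧ b = c) := by
    intro a b c d h
    simp only [hσ] at h
    exact sidon_of_injOn δ0 j hinj π a b c d h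
  -- (3) the structure theorem for the relabelled data
  obtain ⟨φ, hφ, C, m, s, R, μ, Γ, ε, W, hm, hmpos, hdrift, hzeros, hpkg, hV, hsharp, hmono, hint, hsplit⟩ :=
    tightChain (fun ν l => δseq ν (σ l)) (fun l => δ0 (σ l)) (fun l => hδ (σ l)) h05 hsid
      (fun ν l => S ν (σ l)) (fun ν l => hS ν (σ l))
      (fun ν => by obtain ⟨t, ht⟩ := hneS ν; exact ⟨t, by rw [hsum]; exact ht⟩)
      z hz (fun ν i' => by rw [hsum]; exact hroot ν i')
  -- (4) exits
  by_cases hC : 2 ≤ C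
  · refine hchain (fun ν l => δseq ν (σ l)) (fun l => δ0 (σ l)) (fun l => hδ (σ l)) h05 hsid
      (fun ν l => S ν (σ l)) (fun ν l => hS ν (σ l))
      (fun ν => by obtain ⟨t, ht⟩ := hneS ν; exact ⟨t, by rw [hsum]; exact ht⟩)
      z hz (fun ν i' => by rw [hsum]; exact hroot ν i')
      φ hφ C m s R μ Γ ε W hm hmpos hdrift hzeros hpkg hV hsharp hmono hint hsplit ?_ ?_ hC
    -- null-collapse consistency from #32 (member level: dead diagonal pairings, dead mutual pairing, alive witnesses)
    intro c p q r hpp hqq hpq hx hy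
    have hWs : ∀ l, (W c l).IsSymm := (hpkg c).2.2.2.2.1
    obtain ⟨x, hx⟩ := hx
    obtain ⟨y, hy⟩ := hy
    exact polar_eq_zero_iff_of_null_collapse (W c p) (W c q) (W c r) (hWs p) (hWs q)
      (by rw [← Bubbling.polar_self]; exact hpp) (by rw [← Bubbling.polar_self]; exact hqq) hpq
      (ne_zero_of_polar_ne_zero _ _ hx) (ne_zero_of_polar_ne_zero _ _ hy)
    -- proportionality from the tree lemma
    intro c p q hpp hqq hpq hy
    have hWs : ∀ l, (W c l).IsSymm := (hpkg c).2.2.2.2.1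
    obtain ⟨y, hy⟩ := hy
    exact exists_smul_of_polar_eq_zero (hWs p) (hWs q) (by rw [← Bubbling.polar_self]; exact hpp) (by rw [← Bubbling.polar_self]; exact hqq)
      (ne_zero_of_polar_ne_zero _ _ hy) (by simpa [polar] using hpq)
  · -- one cluster: all twenty zeros in the window of cluster `0`; the door forbids it (#16)
    have hC1 : C = 1 := by
      have hCpos : 0 < C := by
        rcases Nat.eq_zero_or_pos C with h0 | h0
        · subst h0
          simp at hm
        · exact h0
      omega
    subst hC1
    have hm0 : m 0 = 20 := by simpa using hm
    refine no_twenty_window_weyl05_of_confluentDoor hdoor (fun ν l => δseq (φ ν) (σ l)) (fun l => δ0 (σ l))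
      (fun l => (hδ (σ l)).comp hφ.tendsto_atTop) h05 hsid
      (fun k l => Real.exp (δseq (φ k) (σ l) * s 0 k) • S (φ k) (σ l)) (fun k l => (hS (φ k) (σ l)).smul _) ?_ (-R) R ?_
    · -- the recentred pencils are not identically zero
      intro k
      obtain ⟨t, ht⟩ := hneS (φ k)
      refine ⟨t - s 0 k, ?_⟩
      rw [← pencil_recenter, add_sub_cancel, hsum]
      exact ht
    · -- twenty zeros in the window
      intro k
      obtain ⟨x, hx, hx'⟩ := hzeros 0 k
      exact ⟨fun i' => x (Fin.cast hm0.symm i'), fun a b hab => hx hab, fun i' => ⟨(hx' _).1, (hx' _).2⟩⟩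


end Summit.ValiantsHypothesis.ValiantsHypothesis.Theorems.LacunarySymmetroidMatrixDescartes.WallBubbling
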